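import Summits.QuantumFields.BalabanUV.Beta.FP.WellConditionedInverseLocality
import Summits.QuantumFields.BalabanUV.Beta.FP.WellConditionedInverseLocalityZd

/-!
# `Summit.QuantumFields.BalabanUV.Beta.FP.WellConditionedInverseLocalityJunction` — road FP, row «WCI»:
# THE TWO HALVES OF THE ROW UNDER ONE STATEMENT SHAPE, AND THEIR JUNCTION

HONEST FRAMING (page 1 of everything in this cell).  Discharging `FlowStep.BetaPertH` would make
Bałaban's ultraviolet stability UNCONDITIONAL — a constructive-QFT result; it is NOT the continuum
limit and NOT the Clay problem.  This module discharges nothing of `BetaPertH`: it is [folklore]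
bookkeeping over two tree modules, BY NAME — the FINITE ∕ TORUS half of row «WCI»
(`FP/WellConditionedInverseLocality`, unit t4-ne9-formalise-leaf-04, over `B4Sect5Torus.inv_decay`)
and the INFINITE-LATTICE half (`FP/WellConditionedInverseLocalityZd`, unit gan24-p3, over pv23's
`B4Sect5Exhaustion.limInv`) — written because the road-FP owner asked the two authors to «share one
statement shape for "0 ⪯ K ⪯ C, exp-local ⟹ (1+K)⁻¹ exp-local with (C′, δ′) explicit"»
(journal l.23656 (2); the ℤᴰ author's shape l.24036).  HONEST DEPENDENCY: continuum YM on T⁴ ⇐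
BetaPertH ∧ nine spine estimates (0/9 proved); BetaPertH ⇐ (D1) ∧ (D4) ∧ CAP+tail; G-an2-4 gates
asym, D1 and NE2/3/4.

THE SHARED SHAPE (the ℤᴰ half's letters, adopted): a kernel `T` is
  (s) symmetric `∀ p q, T p q = T q p`,
  (p) form-nonnegative `∀ v, 0 ≤ Σ_p v p · (T v) p` (on `ℤ^D`: for every finite compression `toMat Λ T`),
  (d) localised `∀ p q, |T p q| ≤ C·e^{−δ·dist(p,q)}` with `0 ≤ C`, `0 < δ`;
CONCLUSION: the inverse of `𝟙 + T` — and ANY left inverse `E` of `𝟙 + T` a consumer brings — obeys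
`|E p q| ≤ C′·e^{−δ′·dist(p,q)}` with the EXPLICIT, VOLUME-FREE pair
`(C′, δ′) = (B4Sect5Proof.cStar D N 1 (1+C) δ, B4Sect5Proof.deltaStar D N 1 (1+C) δ)`
(on a general finite index set with pseudo-distance `ρ` and profile `Kf`: the sharp pair
`(2, B4Sect5Torus.rate Kf 1 (1+C) δ)`).

WHAT IS PROVED (0 sorry, 0 def; nothing of either half is restated — both are used BY NAME):
* §1 FINITE INDEX SETS IN THE SHARED LETTERS.  `posSemidef_of_shape` ((s)+(p) ⟹ Mathlib's
  `Matrix.PosSemidef`, the finite half's hypothesis — so every END of `FP/WellConditionedInverseLocality`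
  is available from the shared shape), `abs_inv_one_add_le_of_shape` (the finite END in the shared
  letters), `inv_one_add_eq_of_left_inverse` (a left inverse in SUM letters
  `Σ_q E(p,q)(𝟙+T)(q,r) = [p = r]` IS `(1 + T)⁻¹` — finite uniqueness, no boundedness needed) and the
  consumer's hook `abs_leftInverse_one_add_le_of_shape` — the literal finite twin of the ℤᴰ half's
  `abs_leftInverse_one_add_le`.
* §2 COMPRESSIONS OF A SHARED-SHAPE KERNEL ON `ℤ^D × Fin N`.  For `T : K D N → K D N → ℝ` with (s)(p)(d):
  `posSemidef_toMat` (every `toMat Λ T` is PSD), `toMat_decay` (decay in `zrho Λ N` = the same sup-distance),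
  **`abs_inv_one_add_toMat_le`** — the finite half's END at EVERY finite volume `Λ` in EXACTLY the ℤᴰ half's
  constants and distance: `|(1 + toMat Λ T)⁻¹ a b| ≤ cStar D N 1 (1+C) δ · e^{−deltaStar D N 1 (1+C) δ · dist(a,b)}`,
  the sharp-rate form `abs_inv_one_add_toMat_le_sharp` (`2·e^{−rate·dist}`), the consumer's hook at a
  compression `abs_leftInverse_one_add_toMat_le`, and the zero-extended reading `abs_finInv_one_add_le`
  (`B4Sect5Exhaustion.finInv`).
* §3 THE JUNCTION — THE TWO HALVES AGREE.  **`tendsto_finInv_one_add`**: the ℤᴰ half's object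
  `limInv univ (𝟙 + T)` IS the entrywise limit of the finite half's objects `(1 + toMat (cut univ n) T)⁻¹`
  along the cube exhaustion (pv23's `tendsto_limInv` at the ℤᴰ half's `hyp56Z_one_add`);
  **`abs_inv_toMat_one_add_sub_limInv_le`**: the finite-volume error is exponentially small in the distance
  to the complement, `|(1 + toMat Λ T)⁻¹ a b − limInv univ (𝟙+T) a b| ≤
  cStar·e^{−deltaStar·(dist(a,b) + dist(a, Λᶜ) + dist(b, Λᶜ))}` ((5.8) BY NAME) — volume independence made
  quantitative for the box consumer; **`wci_shared_shape`**: BOTH ENDs as ONE conjunction with ONE constant pair,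
  the ℤᴰ conjunct RE-DERIVED IN THE PROOF through the finite half's END (uniform in `Λ`) and the exhaustion
  limit rather than cited — the cross-check that the two halves carry one estimate; and the converse junction
  `limInv_coe_one_add_eq_inv_toMat` (on a finite `Ω = Λ` the ℤᴰ object IS the finite object, `limInv_coe_finset`).

ABSOLUTE RULE.  Nothing printed is cited as a fact; no manuscript statement enters as a hypothesis;
nothing landed is restated (BY NAME: `WellConditionedInverseLocality.abs_inv_one_add_le ∕ _zd ∕ _zd_uniform`,
`WellConditionedInverseLocalityZd.toMat_one_add ∕ hyp56Z_one_add ∕ cStar_one_add_pos ∕ deltaStar_one_add_pos`,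
`B4Sect5Exhaustion.toMat ∕ finInv ∕ limInv ∕ cut ∕ finInv_of_mem ∕ finInv_of_not_mem_left ∕ _right ∕
tendsto_limInv ∕ inv_toMat_sub_limInv_abs_le ∕ limInv_coe_finset ∕ inv_toMat_apply ∕ Hyp56Z.mono`, `B4Sect5Torus.zrho ∕ zrho_isPseudoDist ∕ zrho_sumBound ∕
profile_nonneg ∕ rate`, Mathlib `Matrix.PosSemidef.of_dotProduct_mulVec_nonneg ∕ Matrix.inv_eq_left_inv`).
References (method only): J.-M. Combes, L. Thomas, Commun. Math. Phys. 34 (1973) 251–270; T. Bałaban,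
Commun. Math. Phys. 89 (1983) 571–597, Sect. 5 (kernel-proved in the tree by the pv lineage; quoted there,
not here).  Unit `b2b-balaban-t4-ne9-formalise-leaf-04` (gen 37; idle NE9 leaf seat, cross-lane brick for
road FP).  NOT summit progress; 0∕4 row-D1 binders; NOT IR-I, NOT D1, NOT BetaPertH, NOT Clay.
-/

open scoped BigOperators Matrix Topology
open Filter Finset Matrix
open Literature.MathematicalPhysics.QuantumFieldTheory.Balaban1983to89
open Literature.MathematicalPhysics.QuantumFieldTheory.Balaban1983to89.B4Sect5Torus
  (IsPseudoDist SumBound rate zrho zrho_isPseudoDist zrho_sumBound profile_nonneg)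
open Literature.MathematicalPhysics.QuantumFieldTheory.Balaban1983to89.B4Sect5Exhaustion
  (K toMat finInv limInv cut finInv_of_mem finInv_of_not_mem_left finInv_of_not_mem_right tendsto_limInv
    inv_toMat_sub_limInv_abs_le)
open B4Sect5Proof (cStar deltaStar)
open Summit.QuantumFields.BalabanUV.Beta.FP

namespace Summit.QuantumFields.BalabanUV.Beta.FP.WellConditionedInverseLocalityJunction

noncomputable section

/-! ## §1 Finite index sets in the shared letters -/

section Shape

variable {n : Type*} [Fintype n] [DecidableEq n]

omit [DecidableEq n] in
/-- **(s)+(p) ⟹ PSD.**  A real matrix that is symmetric and form-nonnegative in the SUM letters of the shared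
shape (`0 ≤ Σ_p v_p (Tv)_p`) is `Matrix.PosSemidef` — the hypothesis of every END of the finite half
`FP/WellConditionedInverseLocality`. [folklore] -/
theorem posSemidef_of_shape {T : Matrix n n ℝ} (hT : ∀ p q, T p q = T q p)
    (hT0 : ∀ v : n → ℝ, 0 ≤ ∑ p, v p * T.mulVec v p) : T.PosSemidef := by
  refine Matrix.PosSemidef.of_dotProduct_mulVec_nonneg ?_ fun v => ?_
  · exact Matrix.isHermitian_iff_isSymm.mpr (Matrix.IsSymm.ext fun i j => hT j i)
  · simpa [dotProduct] using hT0 v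

omit [DecidableEq n] in
/-- … and conversely: a PSD real matrix has the shared shape (s)+(p). [folklore] -/
theorem shape_of_posSemidef {T : Matrix n n ℝ} (hT : T.PosSemidef) :
    (∀ p q, T p q = T q p) ∧ (∀ v : n → ℝ, 0 ≤ ∑ p, v p * T.mulVec v p) := by
  refine ⟨fun p q => ?_, fun v => ?_⟩
  · have h := WellConditionedInverseLocality.isSymm_of_posSemidef hT
    exact h.apply q p
  · exact WellConditionedInverseLocality.sum_mul_mulVec_nonneg hT v

variable {Kf : ℝ → ℝ}

/-- **The finite END in the shared letters.**  `T` symmetric, form-nonnegative, `|T(p,q)| ≤ C e^{−δρ(p,q)}` for a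
pseudo-distance `ρ` with profile `Kf` (`0 ≤ C`, `0 < δ`):
`|(1 + T)⁻¹(p,q)| ≤ 2·e^{−rate Kf 1 (1+C) δ · ρ(p,q)}` — `WellConditionedInverseLocality.abs_inv_one_add_le`
BY NAME. [folklore] -/
theorem abs_inv_one_add_le_of_shape (hKf : ∀ a, 0 < a → 0 ≤ Kf a) {ρ : n → n → ℝ} (hρ : IsPseudoDist ρ)
    (hS : SumBound ρ Kf) {T : Matrix n n ℝ} (hT : ∀ p q, T p q = T q p)
    (hT0 : ∀ v : n → ℝ, 0 ≤ ∑ p, v p * T.mulVec v p) {C δ : ℝ} (hC : 0 ≤ C) (hδ : 0 < δ)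
    (hdec : ∀ p q, |T p q| ≤ C * Real.exp (-(δ * ρ p q))) (p q : n) :
    |(1 + T)⁻¹ p q| ≤ 2 * Real.exp (-(rate Kf 1 (1 + C) δ * ρ p q)) :=
  WellConditionedInverseLocality.abs_inv_one_add_le hKf hρ hS (posSemidef_of_shape hT hT0) hC hδ hdec p q

/-- **Finite uniqueness in SUM letters — the consumer's hook.**  A kernel `E` with
`Σ_q E(p,q)·(𝟙 + T)(q,r) = [p = r]` IS `(1 + T)⁻¹` (Mathlib `Matrix.inv_eq_left_inv`; over a finite index set no
boundedness hypothesis is needed — contrast the ℤᴰ half's `eq_limInv_one_add_of_left_inverse`). [folklore] -/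
theorem inv_one_add_eq_of_left_inverse {T E : Matrix n n ℝ}
    (hE : ∀ p r, ∑ q, E p q * ((if q = r then (1 : ℝ) else 0) + T q r) = if p = r then 1 else 0) :
    (1 + T)⁻¹ = E := by
  refine Matrix.inv_eq_left_inv (Matrix.ext fun p r => ?_)
  rw [Matrix.mul_apply, Matrix.one_apply, ← hE p r]
  refine Finset.sum_congr rfl fun q _ => ?_
  rw [Matrix.add_apply, Matrix.one_apply]

/-- **The consumer's hook, finite twin of the ℤᴰ half's `abs_leftInverse_one_add_le`.**  Under the shared shape,
ANY left inverse `E` of `𝟙 + T` in sum letters obeys `|E(p,q)| ≤ 2·e^{−rate Kf 1 (1+C) δ · ρ(p,q)}`. [folklore] -/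
theorem abs_leftInverse_one_add_le_of_shape (hKf : ∀ a, 0 < a → 0 ≤ Kf a) {ρ : n → n → ℝ}
    (hρ : IsPseudoDist ρ) (hS : SumBound ρ Kf) {T : Matrix n n ℝ} (hT : ∀ p q, T p q = T q p)
    (hT0 : ∀ v : n → ℝ, 0 ≤ ∑ p, v p * T.mulVec v p) {C δ : ℝ} (hC : 0 ≤ C) (hδ : 0 < δ)
    (hdec : ∀ p q, |T p q| ≤ C * Real.exp (-(δ * ρ p q))) {E : Matrix n n ℝ}
    (hE : ∀ p r, ∑ q, E p q * ((if q = r then (1 : ℝ) else 0) + T q r) = if p = r then 1 else 0)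
    (p q : n) :
    |E p q| ≤ 2 * Real.exp (-(rate Kf 1 (1 + C) δ * ρ p q)) := by
  rw [← inv_one_add_eq_of_left_inverse hE]
  exact abs_inv_one_add_le_of_shape hKf hρ hS hT hT0 hC hδ hdec p q

end Shape

/-! ## §2 Compressions of a shared-shape kernel on `ℤ^D × Fin N` -/

section Compressions

variable {D N : ℕ} {T : K D N → K D N → ℝ} {C δ : ℝ}

/-- Symmetry passes to every compression `toMat Λ T`. [folklore] -/
theorem toMat_symm (hT : ∀ p q, T p q = T q p) (Λ : Finset (Fin D → ℤ)) (a b : B4.Idx Λ N) :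
    toMat Λ T a b = toMat Λ T b a :=
  hT _ _

/-- **Every compression of a shared-shape kernel is PSD** (the finite half's hypothesis, DISCHARGED from the
shared shape at each finite volume `Λ`). [folklore] -/
theorem posSemidef_toMat (hT : ∀ p q, T p q = T q p)
    (hT0 : ∀ (Λ : Finset (Fin D → ℤ)) (v : B4.Idx Λ N → ℝ), 0 ≤ ∑ p, v p * (toMat Λ T).mulVec v p)
    (Λ : Finset (Fin D → ℤ)) : (toMat Λ T).PosSemidef :=
  posSemidef_of_shape (toMat_symm hT Λ) (hT0 Λ)

/-- The decay passes to every compression, in the finite half's distance `zrho Λ N` (= the same sup-distance of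
the underlying sites, `rfl`). [folklore] -/
theorem toMat_decay (hdec : ∀ p q, |T p q| ≤ C * Real.exp (-(δ * dist p.1 q.1)))
    (Λ : Finset (Fin D → ℤ)) (a b : B4.Idx Λ N) :
    |toMat Λ T a b| ≤ C * Real.exp (-(δ * zrho Λ N a b)) :=
  hdec _ _

/-- **The finite half's END at every finite volume, in the ℤᴰ half's constants and distance**: for a kernel `T`
on `ℤ^D × Fin N` of the shared shape and every finite `Λ ⊂ ℤ^D`,
`|(1 + toMat Λ T)⁻¹ a b| ≤ cStar D N 1 (1+C) δ · e^{−deltaStar D N 1 (1+C) δ · dist(a,b)}` — the SAME pair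
`(cStar, deltaStar)` as `WellConditionedInverseLocalityZd.abs_limInv_one_add_le`, for every `Λ`
(`WellConditionedInverseLocality.abs_inv_one_add_le_zd_uniform` BY NAME). [folklore] -/
theorem abs_inv_one_add_toMat_le (hT : ∀ p q, T p q = T q p)
    (hT0 : ∀ (Λ : Finset (Fin D → ℤ)) (v : B4.Idx Λ N → ℝ), 0 ≤ ∑ p, v p * (toMat Λ T).mulVec v p)
    (hC : 0 ≤ C) (hδ : 0 < δ) (hdec : ∀ p q, |T p q| ≤ C * Real.exp (-(δ * dist p.1 q.1)))
    (Λ : Finset (Fin D → ℤ)) (a b : B4.Idx Λ N) :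
    |(1 + toMat Λ T)⁻¹ a b| ≤
      cStar D N 1 (1 + C) δ *
        Real.exp (-(deltaStar D N 1 (1 + C) δ * dist (a.1 : Fin D → ℤ) (b.1 : Fin D → ℤ))) :=
  WellConditionedInverseLocality.abs_inv_one_add_le_zd_uniform Λ (posSemidef_toMat hT hT0 Λ) hC hδ
    (toMat_decay hdec Λ) a b

/-- The same END with the SHARP finite constants `(2, rate (a ↦ N·latticeConst D a) 1 (1+C) δ)`
(`WellConditionedInverseLocality.abs_inv_one_add_le_zd` BY NAME). [folklore] -/
theorem abs_inv_one_add_toMat_le_sharp (hT : ∀ p q, T p q = T q p)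
    (hT0 : ∀ (Λ : Finset (Fin D → ℤ)) (v : B4.Idx Λ N → ℝ), 0 ≤ ∑ p, v p * (toMat Λ T).mulVec v p)
    (hC : 0 ≤ C) (hδ : 0 < δ) (hdec : ∀ p q, |T p q| ≤ C * Real.exp (-(δ * dist p.1 q.1)))
    (Λ : Finset (Fin D → ℤ)) (a b : B4.Idx Λ N) :
    |(1 + toMat Λ T)⁻¹ a b| ≤
      2 * Real.exp (-(rate (fun a => (N : ℝ) * B4Sect5Proof.latticeConst D a) 1 (1 + C) δ
        * dist (a.1 : Fin D → ℤ) (b.1 : Fin D → ℤ))) :=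
  WellConditionedInverseLocality.abs_inv_one_add_le_zd Λ (posSemidef_toMat hT hT0 Λ) hC hδ
    (toMat_decay hdec Λ) a b

/-- **The consumer's hook at a compression, in the ℤᴰ half's exact letters (finite sums)**: any `E` with
`Σ_b E(a,b)·(𝟙 + toMat Λ T)(b,c) = [a = c]` obeys the `(cStar, deltaStar)` bound. [folklore] -/
theorem abs_leftInverse_one_add_toMat_le (hT : ∀ p q, T p q = T q p)
    (hT0 : ∀ (Λ : Finset (Fin D → ℤ)) (v : B4.Idx Λ N → ℝ), 0 ≤ ∑ p, v p * (toMat Λ T).mulVec v p)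
    (hC : 0 ≤ C) (hδ : 0 < δ) (hdec : ∀ p q, |T p q| ≤ C * Real.exp (-(δ * dist p.1 q.1)))
    (Λ : Finset (Fin D → ℤ)) {E : Matrix (B4.Idx Λ N) (B4.Idx Λ N) ℝ}
    (hE : ∀ a c, ∑ b, E a b * ((if b = c then (1 : ℝ) else 0) + toMat Λ T b c) = if a = c then 1 else 0)
    (a b : B4.Idx Λ N) :
    |E a b| ≤
      cStar D N 1 (1 + C) δ *
        Real.exp (-(deltaStar D N 1 (1 + C) δ * dist (a.1 : Fin D → ℤ) (b.1 : Fin D → ℤ))) := by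
  rw [← inv_one_add_eq_of_left_inverse hE]
  exact abs_inv_one_add_toMat_le hT hT0 hC hδ hdec Λ a b

/-- The compression of `𝟙 + T` inverted IS `(1 + toMat Λ T)⁻¹` (`WellConditionedInverseLocalityZd.toMat_one_add`
BY NAME). [folklore] -/
theorem inv_toMat_one_add (Λ : Finset (Fin D → ℤ)) (T : K D N → K D N → ℝ) :
    (toMat Λ (fun p q : K D N => (if p = q then (1 : ℝ) else 0) + T p q))⁻¹ = (1 + toMat Λ T)⁻¹ := by
  rw [WellConditionedInverseLocalityZd.toMat_one_add]

/-- **The zero-extended reading** (`B4Sect5Exhaustion.finInv`, the finite half's object placed on the ambient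
index set): `|finInv Λ (𝟙 + T) p q| ≤ cStar·e^{−deltaStar·dist(p,q)}` for ALL ambient `p q` and every finite
`Λ` (inside `Λ × Λ` it is `abs_inv_one_add_toMat_le`, outside it vanishes). [folklore] -/
theorem abs_finInv_one_add_le (hT : ∀ p q, T p q = T q p)
    (hT0 : ∀ (Λ : Finset (Fin D → ℤ)) (v : B4.Idx Λ N → ℝ), 0 ≤ ∑ p, v p * (toMat Λ T).mulVec v p)
    (hC : 0 ≤ C) (hδ : 0 < δ) (hdec : ∀ p q, |T p q| ≤ C * Real.exp (-(δ * dist p.1 q.1)))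
    (Λ : Finset (Fin D → ℤ)) (p q : K D N) :
    |finInv Λ (fun p q : K D N => (if p = q then (1 : ℝ) else 0) + T p q) p q| ≤
      cStar D N 1 (1 + C) δ * Real.exp (-(deltaStar D N 1 (1 + C) δ * dist p.1 q.1)) := by
  have h0 : 0 ≤ cStar D N 1 (1 + C) δ * Real.exp (-(deltaStar D N 1 (1 + C) δ * dist p.1 q.1)) :=
    mul_nonneg (WellConditionedInverseLocalityZd.cStar_one_add_pos D N C δ).le (Real.exp_pos _).le
  by_cases hp : p.1 ∈ Λ
  · by_cases hq : q.1 ∈ Λ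
    · rw [finInv_of_mem _ hp hq, inv_toMat_one_add]
      exact abs_inv_one_add_toMat_le hT hT0 hC hδ hdec Λ (⟨p.1, hp⟩, p.2) (⟨q.1, hq⟩, q.2)
    · rw [finInv_of_not_mem_right _ hq, abs_zero]
      exact h0
  · rw [finInv_of_not_mem_left _ hp, abs_zero]
    exact h0

end Compressions

/-! ## §3 The junction: the two halves agree -/

section Junction

variable {D N : ℕ} {T : K D N → K D N → ℝ} {C δ : ℝ}

/-- **The ℤᴰ half's object is the limit of the finite half's objects.**  Along the cube exhaustion
`cut univ n = [−n, n]^D`, the zero-extended finite-volume inverses `finInv (cut univ n) (𝟙 + T)` — inside the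
cube, the matrices `(1 + toMat (cut univ n) T)⁻¹` of the finite half — converge ENTRYWISE to
`limInv univ (𝟙 + T)` (pv23's `tendsto_limInv` at the ℤᴰ half's `hyp56Z_one_add`). [folklore] -/
theorem tendsto_finInv_one_add (hT : ∀ p q, T p q = T q p)
    (hT0 : ∀ (Λ : Finset (Fin D → ℤ)) (v : B4.Idx Λ N → ℝ), 0 ≤ ∑ p, v p * (toMat Λ T).mulVec v p)
    (hC : 0 ≤ C) (hδ : 0 < δ) (hdec : ∀ p q, |T p q| ≤ C * Real.exp (-(δ * dist p.1 q.1))) (p q : K D N) :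
    Tendsto (fun n => finInv (cut (Set.univ : Set (Fin D → ℤ)) n)
        (fun p q : K D N => (if p = q then (1 : ℝ) else 0) + T p q) p q)
      atTop (𝓝 (limInv (Set.univ : Set (Fin D → ℤ))
        (fun p q : K D N => (if p = q then (1 : ℝ) else 0) + T p q) p q)) :=
  tendsto_limInv one_pos (by linarith) hδ (WellConditionedInverseLocalityZd.hyp56Z_one_add hT hT0 hdec) p q

/-- **Volume independence, quantitative ((5.8) BY NAME).**  At every finite volume `Λ`, the finite half's inverse
differs from the ℤᴰ half's inverse by an error exponentially small in the distance to the complement: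
`|(1 + toMat Λ T)⁻¹ a b − limInv univ (𝟙 + T) a b| ≤
cStar·e^{−deltaStar·(dist(a,b) + dist(a, ℤ^D ∖ Λ) + dist(b, ℤ^D ∖ Λ))}` (pv23's
`inv_toMat_sub_limInv_abs_le` at the ℤᴰ half's `hyp56Z_one_add`, `toMat_one_add`). [folklore] -/
theorem abs_inv_toMat_one_add_sub_limInv_le (hT : ∀ p q, T p q = T q p)
    (hT0 : ∀ (Λ : Finset (Fin D → ℤ)) (v : B4.Idx Λ N → ℝ), 0 ≤ ∑ p, v p * (toMat Λ T).mulVec v p)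
    (hC : 0 ≤ C) (hδ : 0 < δ) (hdec : ∀ p q, |T p q| ≤ C * Real.exp (-(δ * dist p.1 q.1)))
    (Λ : Finset (Fin D → ℤ)) (a b : B4.Idx Λ N) :
    |(1 + toMat Λ T)⁻¹ a b -
        limInv (Set.univ : Set (Fin D → ℤ)) (fun p q : K D N => (if p = q then (1 : ℝ) else 0) + T p q)
          ((a.1 : Fin D → ℤ), a.2) ((b.1 : Fin D → ℤ), b.2)| ≤
      cStar D N 1 (1 + C) δ * Real.exp (-(deltaStar D N 1 (1 + C) δ *
        (dist (a.1 : Fin D → ℤ) (b.1 : Fin D → ℤ)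
          + Metric.infDist (a.1 : Fin D → ℤ) (Set.univ \ ↑Λ)
          + Metric.infDist (b.1 : Fin D → ℤ) (Set.univ \ ↑Λ)))) := by
  rw [← inv_toMat_one_add Λ T]
  exact inv_toMat_sub_limInv_abs_le one_pos (by linarith) hδ
    (WellConditionedInverseLocalityZd.hyp56Z_one_add hT hT0 hdec) Λ (Set.subset_univ _) a b

/-- **One estimate, two halves**: the ℤᴰ half's END and the finite half's END at every compression hold
TOGETHER with ONE pair of constants `(cStar D N 1 (1+C) δ, deltaStar D N 1 (1+C) δ)` — the shared statement
shape the road-FP owner asked for, as a single conjunction.  CROSS-CHECK BUILT INTO THE PROOF: the first conjunct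
— whose statement is `WellConditionedInverseLocalityZd.abs_limInv_one_add_le` — is NOT obtained by citing the ℤᴰ
half's END but RE-DERIVED through the finite half: the finite bound `abs_finInv_one_add_le`, UNIFORM in the volume,
passed to the exhaustion limit `tendsto_finInv_one_add` (`le_of_tendsto'`); the second conjunct is
`abs_inv_one_add_toMat_le`.  So the two halves provably carry one estimate. [folklore] -/
theorem wci_shared_shape (hT : ∀ p q, T p q = T q p)
    (hT0 : ∀ (Λ : Finset (Fin D → ℤ)) (v : B4.Idx Λ N → ℝ), 0 ≤ ∑ p, v p * (toMat Λ T).mulVec v p)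
    (hC : 0 ≤ C) (hδ : 0 < δ) (hdec : ∀ p q, |T p q| ≤ C * Real.exp (-(δ * dist p.1 q.1))) :
    (∀ p q : K D N,
      |limInv (Set.univ : Set (Fin D → ℤ)) (fun p q : K D N => (if p = q then (1 : ℝ) else 0) + T p q) p q|
        ≤ cStar D N 1 (1 + C) δ * Real.exp (-(deltaStar D N 1 (1 + C) δ * dist p.1 q.1))) ∧
    (∀ (Λ : Finset (Fin D → ℤ)) (a b : B4.Idx Λ N),
      |(1 + toMat Λ T)⁻¹ a b| ≤
        cStar D N 1 (1 + C) δ *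
          Real.exp (-(deltaStar D N 1 (1 + C) δ * dist (a.1 : Fin D → ℤ) (b.1 : Fin D → ℤ)))) :=
  ⟨fun p q => le_of_tendsto' (tendsto_finInv_one_add hT hT0 hC hδ hdec p q).abs fun n =>
      abs_finInv_one_add_le hT hT0 hC hδ hdec (cut (Set.univ : Set (Fin D → ℤ)) n) p q,
    fun Λ a b => abs_inv_one_add_toMat_le hT hT0 hC hδ hdec Λ a b⟩

/-- **The finite half recovered from the ℤᴰ half at a finite volume** (the converse junction): for a FINITE
`Λ`, the ℤᴰ half's object on `Ω = Λ` IS the finite half's object — `limInv ↑Λ (𝟙 + T) p q = (1 + toMat Λ T)⁻¹`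
at indices in `Λ` (pv23's `limInv_coe_finset`: the exhaustion is eventually constant). [folklore] -/
theorem limInv_coe_one_add_eq_inv_toMat (hT : ∀ p q, T p q = T q p)
    (hT0 : ∀ (Λ : Finset (Fin D → ℤ)) (v : B4.Idx Λ N → ℝ), 0 ≤ ∑ p, v p * (toMat Λ T).mulVec v p)
    (hC : 0 ≤ C) (hδ : 0 < δ) (hdec : ∀ p q, |T p q| ≤ C * Real.exp (-(δ * dist p.1 q.1)))
    (Λ : Finset (Fin D → ℤ)) (a b : B4.Idx Λ N) :
    limInv (↑Λ : Set (Fin D → ℤ)) (fun p q : K D N => (if p = q then (1 : ℝ) else 0) + T p q)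
        ((a.1 : Fin D → ℤ), a.2) ((b.1 : Fin D → ℤ), b.2) = (1 + toMat Λ T)⁻¹ a b := by
  rw [B4Sect5Exhaustion.limInv_coe_finset one_pos (by linarith : (0 : ℝ) < 1 + C) hδ Λ
      ((WellConditionedInverseLocalityZd.hyp56Z_one_add hT hT0 hdec).mono (Set.subset_univ _)) _ _,
    ← inv_toMat_one_add Λ T, B4Sect5Exhaustion.inv_toMat_apply]

end Junction

end

end Summit.QuantumFields.BalabanUV.Beta.FP.WellConditionedInverseLocalityJunction
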